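import Mathlib
import Literature.GroupTheory.CombinatorialGroupTheory.SignedHurwitzAction
import HarnessLib

/-!
# Stabilisation-pair moves on integral signed words, and reachability

Companion to `SignedHurwitzAction.lean` (the signed Hurwitz action of the braid group on words of
classes with its Picard–Lefschetz shadow).  This file records the algebraic shadow of the second
move used when sorting matched (achiral) Lefschetz fibrations: the COMMON POSITIVE
STABILISATION PAIR of a bisection (Etnyre–Fuller, Baykur [Baykur2006, §5]; two 1-handles turn the
page `F_{g,1}` into `F_{g+1,1}` and two new vanishing cycles `γ₁, γ₂` enter, positively on one
side and — read with the signs of the closed-up manifold — negatively on the other).  In a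
symplectic basis of `H₁(F_{g+1,1}) = ℤ^{2g} ⊕ ⟨e, f⟩` extending the old one, `[γ₂] = f`,
`[γ₁] = e + c` where `c ∈ ℤ^{2g}` is the Poincaré dual of the intersection functional of the
proper arc of `γ₁` in the old page (a PRIMITIVE class, or `0` for a boundary-parallel arc), and in
the one-word model of a bisection (`W = w₁ · rev(w₂)⁻¹`, cut at the junction) the move inserts the
block `(e + c, +) (f, +) (f, −) (e + c, −)` at the cut.  Everything here is a definition or a
proved bookkeeping lemma; NOTHING geometric is asserted (the realisation of these moves by actual
stabilisations is the business of the dictionary stub of the skeleton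
`Summits/SmoothPoincare4/SmoothPoincare4/Cruxes/AcyclicBisectionExists/Lines/modp-braid-orbits.lean`).

Contents: `IntWord g`; `IsPrimitive`; the genus-raising embedding `embed` with the new basis
vectors `newE`, `newF`; `stabBlock`, `StabStep`; the reachability relation `Reach` (signed
Hurwitz moves for `stdSymp ℤ` at the current genus, and stabilisation-pair moves), with
`Reach.trans`, `Reach.of_hurwitzOrbit`; evaluation lemmas for `embed`/`newE`/`newF` against
`stdSymp`.
-/

noncomputable section

namespace Literature.GroupTheory.CombinatorialGroupTheory.SignedHurwitz

/-- Integral signed words at genus `g`: letters in `ℤ^{2g} = H₁(F_{g,1}; ℤ)` (symplectic basis,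
pairing `stdSymp ℤ g`) with a sign. [folklore] -/
abbrev IntWord (g : ℕ) := List ((Fin g ⊕ Fin g → ℤ) × Bool)

/-- A PRIMITIVE integer vector: every common divisor of its coordinates is a unit (for
`H₁(F, ∂F) ≅ H¹(F)` of a surface with connected boundary these are exactly the classes of embedded
non-separating proper arcs). [folklore] -/
def IsPrimitive {ι : Type*} (c : ι → ℤ) : Prop := ∀ d : ℤ, (∀ i, d ∣ c i) → IsUnit d

/-- The genus-raising embedding `ℤ^{2g} → ℤ^{2g+2}`: old coordinates in the slots `Fin.castSucc _`
of both summands, `0` in the two new slots `Fin.last g`. [folklore] -/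
def embed (g : ℕ) (v : Fin g ⊕ Fin g → ℤ) : Fin (g + 1) ⊕ Fin (g + 1) → ℤ :=
  Sum.elim (Fin.snoc (fun j => v (Sum.inl j)) 0) (Fin.snoc (fun j => v (Sum.inr j)) 0)

/-- The first new basis vector `e = e_{g+1}` of `ℤ^{2g+2}`. [folklore] -/
def newE (g : ℕ) : Fin (g + 1) ⊕ Fin (g + 1) → ℤ := Pi.single (Sum.inl (Fin.last g)) 1

/-- The second new basis vector `f = f_{g+1}` of `ℤ^{2g+2}` (so `stdSymp ℤ (g+1) e f = 1`). [folklore] -/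
def newF (g : ℕ) : Fin (g + 1) ⊕ Fin (g + 1) → ℤ := Pi.single (Sum.inr (Fin.last g)) 1

/-- The STABILISATION BLOCK with arc class `c`: `(e + c, +) (f, +) (f, −) (e + c, −)` (the two new
vanishing cycles, positive on the left piece, negative — in the signs of the closed-up manifold —
on the right piece). [folklore] -/
def stabBlock (g : ℕ) (c : Fin g ⊕ Fin g → ℤ) : IntWord (g + 1) :=
  [(newE g + embed g c, true), (newF g, true), (newF g, false), (newE g + embed g c, false)]

/-- One STABILISATION-PAIR MOVE: cut the word as `A ++ B`, raise the genus by one (old letters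
embedded by `embed`), and insert the stabilisation block of a primitive-or-zero arc class `c` at
the cut. [folklore] -/
def StabStep (g : ℕ) (l : IntWord g) (l' : IntWord (g + 1)) : Prop :=
  ∃ (A B : IntWord g) (c : Fin g ⊕ Fin g → ℤ), (c = 0 ∨ IsPrimitive c) ∧ l = A ++ B ∧
    l' = mapWord (embed g) A ++ stabBlock g c ++ mapWord (embed g) B

/-- REACHABILITY of `(g', l')` from `(g, l)`: finitely many signed Hurwitz moves (for the standard
symplectic pairing at the current genus) and stabilisation-pair moves, in any order. [folklore] -/
inductive Reach : (g : ℕ) → IntWord g → (g' : ℕ) → IntWord g' → Prop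
  /-- no move -/
  | refl (g : ℕ) (l : IntWord g) : Reach g l g l
  /-- one more signed Hurwitz move at the current genus -/
  | hurwitz {g : ℕ} {l : IntWord g} {g' : ℕ} {l' l'' : IntWord g'} :
      Reach g l g' l' → HurwitzStep (stdSymp ℤ g') l' l'' → Reach g l g' l''
  /-- one more stabilisation-pair move -/
  | stab {g : ℕ} {l : IntWord g} {g' : ℕ} {l' : IntWord g'} {l'' : IntWord (g' + 1)} :
      Reach g l g' l' → StabStep g' l' l'' → Reach g l (g' + 1) l''

/-! ## Bookkeeping lemmas -/

/-- A Hurwitz orbit at fixed genus is reachable. [folklore] -/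
theorem Reach.of_hurwitzOrbit {g : ℕ} {l l' : IntWord g} (h : HurwitzOrbit (stdSymp ℤ g) l l') :
    Reach g l g l' := by
  unfold HurwitzOrbit at h
  induction h with
  | refl => exact Reach.refl g l
  | tail _ hstep ih => exact ih.hurwitz hstep

/-- Reachability followed by a Hurwitz orbit at the final genus is reachability. [folklore] -/
theorem Reach.trans_hurwitzOrbit {g : ℕ} {l : IntWord g} {g' : ℕ} {l' l'' : IntWord g'}
    (h : Reach g l g' l') (h' : HurwitzOrbit (stdSymp ℤ g') l' l'') : Reach g l g' l'' := by
  unfold HurwitzOrbit at h'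
  induction h' with
  | refl => exact h
  | tail _ hstep ih => exact ih.hurwitz hstep

/-- Reachability is transitive. [folklore] -/
theorem Reach.trans {g : ℕ} {l : IntWord g} {g' : ℕ} {l' : IntWord g'} {g'' : ℕ} {l'' : IntWord g''}
    (h : Reach g l g' l') (h' : Reach g' l' g'' l'') : Reach g l g'' l'' := by
  induction h' with
  | refl => exact h
  | hurwitz _ hstep ih => exact ih.hurwitz hstep
  | stab _ hstep ih => exact ih.stab hstep

/-- One stabilisation-pair move is reachable. [folklore] -/
theorem StabStep.reach {g : ℕ} {l : IntWord g} {l' : IntWord (g + 1)} (h : StabStep g l l') :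
    Reach g l (g + 1) l' :=
  (Reach.refl g l).stab h

/-- `embed` on an old `inl` coordinate. [folklore] -/
@[simp] theorem embed_inl_castSucc (g : ℕ) (v : Fin g ⊕ Fin g → ℤ) (j : Fin g) :
    embed g v (Sum.inl j.castSucc) = v (Sum.inl j) := by
  simp [embed]

/-- `embed` on an old `inr` coordinate. [folklore] -/
@[simp] theorem embed_inr_castSucc (g : ℕ) (v : Fin g ⊕ Fin g → ℤ) (j : Fin g) :
    embed g v (Sum.inr j.castSucc) = v (Sum.inr j) := by
  simp [embed]

/-- `embed` vanishes on the new `inl` coordinate. [folklore] -/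
@[simp] theorem embed_inl_last (g : ℕ) (v : Fin g ⊕ Fin g → ℤ) : embed g v (Sum.inl (Fin.last g)) = 0 := by
  simp [embed]

/-- `embed` vanishes on the new `inr` coordinate. [folklore] -/
@[simp] theorem embed_inr_last (g : ℕ) (v : Fin g ⊕ Fin g → ℤ) : embed g v (Sum.inr (Fin.last g)) = 0 := by
  simp [embed]

/-- `embed` is additive. [folklore] -/
theorem embed_add (g : ℕ) (v w : Fin g ⊕ Fin g → ℤ) : embed g (v + w) = embed g v + embed g w := by
  ext i
  rcases i with i | i <;> induction i using Fin.lastCases <;> simp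

/-- `embed` commutes with integer scalars. [folklore] -/
theorem embed_smul (g : ℕ) (c : ℤ) (v : Fin g ⊕ Fin g → ℤ) : embed g (c • v) = c • embed g v := by
  ext i
  rcases i with i | i <;> induction i using Fin.lastCases <;> simp

/-- `embed` vanishes only on `0`. [folklore] -/
theorem embed_zero (g : ℕ) : embed g 0 = 0 := by
  ext i
  rcases i with i | i <;> induction i using Fin.lastCases <;> simp

/-- `embed` as a `ℤ`-linear map. [folklore] -/
def embedₗ (g : ℕ) : (Fin g ⊕ Fin g → ℤ) →ₗ[ℤ] (Fin (g + 1) ⊕ Fin (g + 1) → ℤ) where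
  toFun := embed g
  map_add' := embed_add g
  map_smul' := embed_smul g

/-- `embedₗ` is `embed`. [folklore] -/
@[simp] theorem embedₗ_apply (g : ℕ) (v : Fin g ⊕ Fin g → ℤ) : embedₗ g v = embed g v := rfl

/-- `embed` is injective. [folklore] -/
theorem embed_injective (g : ℕ) : Function.Injective (embed g) := by
  intro v w h
  ext i
  rcases i with j | j
  · simpa using congrFun h (Sum.inl j.castSucc)
  · simpa using congrFun h (Sum.inr j.castSucc)

/-- Closed formula for the standard symplectic pairing over `ℤ`:
`ω(x, y) = ∑ᵢ (x (inl i) * y (inr i) - x (inr i) * y (inl i))`. [folklore] -/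
theorem stdSymp_int_apply (g : ℕ) (x y : Fin g ⊕ Fin g → ℤ) :
    stdSymp ℤ g x y = ∑ i, (x (Sum.inl i) * y (Sum.inr i) - x (Sum.inr i) * y (Sum.inl i)) := by
  rw [Finset.sum_sub_distrib, sub_eq_add_neg]
  simp [stdSymp, Matrix.toLinearMap₂'_apply', dotProduct, Matrix.mulVec,
    Fintype.sum_sum_type, Matrix.fromBlocks, Matrix.one_apply]

/-- `embed` is isometric for the standard symplectic pairings. [folklore] -/
theorem stdSymp_embed_embed (g : ℕ) (v w : Fin g ⊕ Fin g → ℤ) :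
    stdSymp ℤ (g + 1) (embed g v) (embed g w) = stdSymp ℤ g v w := by
  simp [stdSymp_int_apply, Fin.sum_univ_castSucc]

/-- Old classes are orthogonal to the new `e`. [folklore] -/
@[simp] theorem stdSymp_embed_newE (g : ℕ) (v : Fin g ⊕ Fin g → ℤ) :
    stdSymp ℤ (g + 1) (embed g v) (newE g) = 0 := by
  simp [stdSymp_int_apply, newE, Pi.single_apply, Sum.inl.injEq]

/-- The new `e` is orthogonal to old classes. [folklore] -/
@[simp] theorem stdSymp_newE_embed (g : ℕ) (v : Fin g ⊕ Fin g → ℤ) :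
    stdSymp ℤ (g + 1) (newE g) (embed g v) = 0 := by
  simp [stdSymp_int_apply, newE, Pi.single_apply, Sum.inl.injEq]

/-- Old classes are orthogonal to the new `f`. [folklore] -/
@[simp] theorem stdSymp_embed_newF (g : ℕ) (v : Fin g ⊕ Fin g → ℤ) :
    stdSymp ℤ (g + 1) (embed g v) (newF g) = 0 := by
  simp [stdSymp_int_apply, newF, Pi.single_apply, Sum.inr.injEq]

/-- The new `f` is orthogonal to old classes. [folklore] -/
@[simp] theorem stdSymp_newF_embed (g : ℕ) (v : Fin g ⊕ Fin g → ℤ) :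
    stdSymp ℤ (g + 1) (newF g) (embed g v) = 0 := by
  simp [stdSymp_int_apply, newF, Pi.single_apply, Sum.inr.injEq]

/-- `ω(e, f) = 1`. [folklore] -/
@[simp] theorem stdSymp_newE_newF (g : ℕ) : stdSymp ℤ (g + 1) (newE g) (newF g) = 1 := by
  simp [stdSymp_int_apply, newE, newF, Pi.single_apply, Sum.inl.injEq, Sum.inr.injEq]

/-- `ω(f, e) = -1`. [folklore] -/
@[simp] theorem stdSymp_newF_newE (g : ℕ) : stdSymp ℤ (g + 1) (newF g) (newE g) = -1 := by
  simp [stdSymp_int_apply, newE, newF, Pi.single_apply, Sum.inl.injEq, Sum.inr.injEq]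

/-- `ω(e, e) = 0`. [folklore] -/
@[simp] theorem stdSymp_newE_newE (g : ℕ) : stdSymp ℤ (g + 1) (newE g) (newE g) = 0 := by
  simp [stdSymp_int_apply, newE, Pi.single_apply]

/-- `ω(f, f) = 0`. [folklore] -/
@[simp] theorem stdSymp_newF_newF (g : ℕ) : stdSymp ℤ (g + 1) (newF g) (newF g) = 0 := by
  simp [stdSymp_int_apply, newF, Pi.single_apply]

/-- Every vector of `ℤ^{2g+2}` decomposes along old slots and the new pair. [folklore] -/
theorem exists_eq_embed_add (g : ℕ) (x : Fin (g + 1) ⊕ Fin (g + 1) → ℤ) :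
    ∃ (y : Fin g ⊕ Fin g → ℤ) (a b : ℤ), x = embed g y + a • newE g + b • newF g := by
  refine ⟨Sum.elim (fun j => x (Sum.inl j.castSucc)) (fun j => x (Sum.inr j.castSucc)),
    x (Sum.inl (Fin.last g)), x (Sum.inr (Fin.last g)), ?_⟩
  ext i
  rcases i with i | i <;> induction i using Fin.lastCases <;>
    simp [newE, newF, Fin.castSucc_ne_last]

end Literature.GroupTheory.CombinatorialGroupTheory.SignedHurwitz

end
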